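import Mathlib
import HarnessLib
import Literature.Computability.AlgebraicComplexity.PatternExpressions
import Summits.ValiantsHypothesis.ValiantsHypothesis.Theorems.MonotoneRestorationMonotoneRestorationQPLinearWidthDefs
import Summits.ValiantsHypothesis.ValiantsHypothesis.Theorems.MonotoneRestorationOrbitRestorationQPHomTensorEigen
import Summits.ValiantsHypothesis.ValiantsHypothesis.Theorems.MonotoneRestorationMonotoneRestorationQPHomExpansionUnique

/-!
# Route MonotoneRestoration, crux `MonotoneRestorationQP` (stmt-15886), line `linear_width` —
# WEIGHTED DESCRIPTIVE-COMPLEXITY MONOTONICITY BY KRONECKER ISOLATION (no padding step)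

Helper file (`--supports stmt-ValiantsHypothesis-15886`), def-free.

The rung `stub_linearDegreeWidthRestoration` (`∀ c, WidthRung fun n => c * (n + 1)`) and GAP 1 `stub_degreeLifting`
of `Cruxes/MonotoneRestorationQP/Lines/linear_width.lean` carry the hypothesis `PolylogHomDetermined f`: the values of
`f n` at points of `ℂ^{n×n}` — EDGE-WEIGHTED `(n,n)`-vertex bipartite graphs with COMPLEX weights — are determined by
`HomIndist n k`, equality of all homomorphism polynomials of bipartite multigraph patterns of treewidth `< k`.  In print
(Dawar–Pago–Seppelt 2025, Thm 7.9 / Thm 7.11, "descriptive complexity monotonicity") the passage from "the linear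
combination `p_n = Σ_i α_i hom_{F_i,n}` is determined" to "each pattern `F_i` is individually determined" is done for
SIMPLE host graphs by tensoring with an auxiliary host `K` and PADDING with isolated vertices, and needs the patterns to
have SUBLINEAR volume (`|F_i| ≤ min{n,m}/ν`).  This file certifies the same isolation step in the tree's weighted currency,
where padding is unnecessary: the Kronecker (categorical) product with an arbitrary WEIGHTED factor is a congruence for
`HomIndist` (`homIndist_kronecker`, from the landed multiplicativity `HomTensor.homPoly_kronecker_eval`), the Kronecker
substitution of a determined polynomial therefore does not depend on the scalar factor inside a `HomIndist` class
(`kroneckerSubst_eq_of_determined`, by `MvPolynomial.funext` over `ℂ`), and uniqueness of homomorphism expansions at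
volume `≤ m` (`HomExpansionUnique.homPoly_linearIndependent`, Dwivedi–Pago–Seppelt 2026 Lem 8.18) isolates every pattern:

* `eval_kroneckerSubst` — the Kronecker substitution `x_{pq} ↦ z_{(e p).2,(e q).2} · x_{(e p).1,(e q).1}` along
  `e : Fin N ≃ Fin m × Fin ν` followed by evaluation at `y ∈ ℂ^{m×m}` is evaluation at the Kronecker point `y ⊗_e z`;
* `homIndist_kronecker` — `HomIndist ν k z z' → HomIndist N k (y ⊗_e z) (y ⊗_e z')` for every weighted `y`;
* `kroneckerSubst_eq_of_determined` — for `p` determined by `HomIndist N k` and `HomIndist ν k z z'`, the two Kronecker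
  substitutions of `p` coincide as polynomials in the `m × m` variables;
* `coeff_mul_sub_eval_eq_zero_of_determined` — **MONOTONICITY**: if `p = Σ_i α_i · hom_{F_i,N}` with pairwise
  non-isomorphic isolated-vertex-free patterns `F_i` having at most `m` vertices a side, `p` is determined by `HomIndist N k`
  and `N` is glued from `m` and `ν` (`Fin N ≃ Fin m × Fin ν`), then for every pair `z, z' ∈ ℂ^{ν×ν}` with `HomIndist ν k z z'`
  and every `i`: `α_i · (hom_{F_i,ν}(z) − hom_{F_i,ν}(z')) = 0`;
* `eval_homPoly_eq_of_determined_of_coeff_ne_zero` — hence every pattern with a nonzero coefficient is itself determined by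
  `HomIndist ν k` at the smaller level `ν` (it lies in the weighted non-uniform homomorphism-distinguishing closure
  `cl_ν` of treewidth `< k`), with NO largeness condition on `ν` and no padding;
* `eval_homPoly_eq_of_polylogHomDetermined` — the family form: under `PolylogHomDetermined f` (unfolded verbatim), at every
  level `N = m·ν` every pattern of volume `≤ m` a side occurring in the hom expansion of `f N` is determined at level `ν` by
  `HomIndist ν ((log₂ N + c)^c)`.

What this does and does not give (census, evidence KRONECKER-MONOTONICITY-g11.md): with a named homomorphism-distinguishing
closedness input (Neuen 2024 / DPS25 Thm 7.3, not in the tree) it recovers the sublinear-volume dichotomy DPS25 Thm 7.9 for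
complex-weighted counting width; at LINEAR volume (the rung) the isolated patterns are those of volume `≤ N/ν`, so the
residue of the rung is exactly the patterns with a component of volume `> N/ν` for every fixed `ν` — giant components.
Honest label: the in-print isolation step in weighted currency; no stub closed; the rung, the cruxes and VP ≠ VNP NOT moved.
[cite: DawarPagoSeppelt2025, Thm 7.9, Thm 7.11 (Claim 3); DwivediPagoSeppelt2026, Lemma 8.18; Lovasz1967, §2]
-/

set_option linter.dupNamespace false

noncomputable section

open scoped Classical

namespace Summit.ValiantsHypothesis.ValiantsHypothesis.Theorems.KroneckerMonotonicity

open MvPolynomial Literature.Computability.AlgebraicComplexity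
open Summit.ValiantsHypothesis.ValiantsHypothesis.Theorems.MonotoneRestorationQPLinearWidth

universe u

/-- The Kronecker substitution `x_{pq} ↦ z_{(e p).2,(e q).2} · x_{(e p).1,(e q).1}` followed by evaluation at `y` is
evaluation at the Kronecker point `(p, q) ↦ z_{(e p).2,(e q).2} · y_{(e p).1,(e q).1}`. [folklore] -/
theorem eval_kroneckerSubst {N m ν : ℕ} (e : Fin N ≃ Fin m × Fin ν) (z : Fin ν × Fin ν → ℂ)
    (y : Fin m × Fin m → ℂ) (p : MvPolynomial (Fin N × Fin N) ℂ) :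
    eval y (aeval (fun pq : Fin N × Fin N =>
        (C (z ((e pq.1).2, (e pq.2).2)) * X ((e pq.1).1, (e pq.2).1) : MvPolynomial (Fin m × Fin m) ℂ)) p) =
      eval (fun pq : Fin N × Fin N => z ((e pq.1).2, (e pq.2).2) * y ((e pq.1).1, (e pq.2).1)) p := by
  induction p using MvPolynomial.induction_on with
  | C c => rw [algHom_C, algebraMap_eq, eval_C, eval_C]
  | add p q hp hq => rw [map_add, map_add, map_add, hp, hq]
  | mul_X p pq hp => rw [map_mul, map_mul, map_mul, hp, aeval_X, map_mul, eval_C, eval_X, eval_X]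

/-- **The Kronecker product with a weighted factor is a congruence for `HomIndist`.**  If `z, z' ∈ ℂ^{ν×ν}` are
hom-indistinguishable below treewidth `k`, then so are the Kronecker points `y ⊗_e z`, `y ⊗_e z'` of level `N`, for every
weighted `y ∈ ℂ^{m×m}` (multiplicativity of homomorphism polynomials, `HomTensor.homPoly_kronecker_eval`).
[cite: DawarPagoSeppelt2025, Thm 7.11 (Claim 3); Lovasz1967, §2] -/
theorem homIndist_kronecker {N m ν k : ℕ} (e : Fin N ≃ Fin m × Fin ν) {z z' : Fin ν × Fin ν → ℂ}
    (h : HomIndist ν k z z') (y : Fin m × Fin m → ℂ) :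
    HomIndist N k (fun pq : Fin N × Fin N => z ((e pq.1).2, (e pq.2).2) * y ((e pq.1).1, (e pq.2).1))
      (fun pq : Fin N × Fin N => z' ((e pq.1).2, (e pq.2).2) * y ((e pq.1).1, (e pq.2).1)) := by
  intro a b E htw
  rw [← eval_kroneckerSubst e z y, ← eval_kroneckerSubst e z' y, HomTensor.homPoly_kronecker_eval E e ℂ z,
    HomTensor.homPoly_kronecker_eval E e ℂ z', map_mul, map_mul, eval_C, eval_C, h a b E htw]

/-- **The Kronecker substitution of a DETERMINED polynomial does not see the scalar factor inside a `HomIndist` class.**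
If `p ∈ ℂ[x_{pq} : p, q < N]` takes equal values at any two points hom-indistinguishable below treewidth `k`, and
`HomIndist ν k z z'`, then substituting `x_{pq} ↦ z_{(e p).2,(e q).2} · x_{(e p).1,(e q).1}` or
`x_{pq} ↦ z'_{(e p).2,(e q).2} · x_{(e p).1,(e q).1}` gives the same polynomial in the `m × m` variables
(`MvPolynomial.funext` over the infinite field `ℂ`). [cite: DawarPagoSeppelt2025, Thm 7.11 (Claim 3)] -/
theorem kroneckerSubst_eq_of_determined {N m ν k : ℕ} (e : Fin N ≃ Fin m × Fin ν)
    {p : MvPolynomial (Fin N × Fin N) ℂ}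
    (hdet : ∀ A B : Fin N × Fin N → ℂ, HomIndist N k A B → eval A p = eval B p)
    {z z' : Fin ν × Fin ν → ℂ} (h : HomIndist ν k z z') :
    aeval (fun pq : Fin N × Fin N =>
        (C (z ((e pq.1).2, (e pq.2).2)) * X ((e pq.1).1, (e pq.2).1) : MvPolynomial (Fin m × Fin m) ℂ)) p =
      aeval (fun pq : Fin N × Fin N =>
        (C (z' ((e pq.1).2, (e pq.2).2)) * X ((e pq.1).1, (e pq.2).1) : MvPolynomial (Fin m × Fin m) ℂ)) p := by
  refine MvPolynomial.funext fun y => ?_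
  rw [eval_kroneckerSubst, eval_kroneckerSubst]
  exact hdet _ _ (homIndist_kronecker e h y)

/-- The Kronecker substitution of a finite linear combination of homomorphism polynomials at level `N` is the linear
combination at level `m` with coefficients rescaled by the values `hom_{F_i,ν}(z)`. [cite: Lovasz1967, §2] -/
theorem kroneckerSubst_sum_homPoly {N m ν M : ℕ} (e : Fin N ≃ Fin m × Fin ν) (z : Fin ν × Fin ν → ℂ)
    (a b : Fin M → ℕ) (E : (i : Fin M) → Multiset (Fin (a i) × Fin (b i))) (α : Fin M → ℂ) :
    aeval (fun pq : Fin N × Fin N =>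
        (C (z ((e pq.1).2, (e pq.2).2)) * X ((e pq.1).1, (e pq.2).1) : MvPolynomial (Fin m × Fin m) ℂ))
        (∑ i, C (α i) * homPoly (E i) N ℂ) =
      ∑ i, C (α i * eval z (homPoly (E i) ν ℂ)) * homPoly (E i) m ℂ := by
  rw [map_sum]
  refine Finset.sum_congr rfl fun i _ => ?_
  rw [map_mul, HomTensor.homPoly_kronecker_eval (E i) e ℂ z, algHom_C, algebraMap_eq, map_mul, mul_assoc]

/-- **WEIGHTED DESCRIPTIVE-COMPLEXITY MONOTONICITY (Kronecker isolation).**  Let `p = Σ_i α_i · hom_{F_i,N}` be a linear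
combination of homomorphism polynomials of pairwise non-isomorphic bipartite multigraph patterns `F_i` without isolated
vertices and with at most `m` vertices on each side, at a level `N` glued from `m` and `ν` (`e : Fin N ≃ Fin m × Fin ν`).
If `p` is determined by `HomIndist N k` on `ℂ^{N×N}`, then for all `z, z' ∈ ℂ^{ν×ν}` with `HomIndist ν k z z'` and every `i`,
`α_i · (hom_{F_i,ν}(z) − hom_{F_i,ν}(z')) = 0`: each pattern is isolated (no padding, no largeness condition on `ν`).
[cite: DawarPagoSeppelt2025, Thm 7.9 and Thm 7.11 (Claim 3); DwivediPagoSeppelt2026, Lemma 8.18] -/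
theorem coeff_mul_sub_eval_eq_zero_of_determined {N m ν k M : ℕ} (e : Fin N ≃ Fin m × Fin ν)
    (a b : Fin M → ℕ) (E : (i : Fin M) → Multiset (Fin (a i) × Fin (b i))) (α : Fin M → ℂ)
    (hle : ∀ i, a i ≤ m ∧ b i ≤ m)
    (hrow : ∀ i (u : Fin (a i)), ∃ x ∈ E i, x.1 = u)
    (hcol : ∀ i (v : Fin (b i)), ∃ x ∈ E i, x.2 = v)
    (hiso : ∀ i j, i ≠ j → ∀ (ea : Fin (a i) ≃ Fin (a j)) (eb : Fin (b i) ≃ Fin (b j)),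
      ((E i).map fun x => (ea x.1, eb x.2)) ≠ E j)
    (hdet : ∀ A B : Fin N × Fin N → ℂ, HomIndist N k A B →
      eval A (∑ i, C (α i) * homPoly (E i) N ℂ) = eval B (∑ i, C (α i) * homPoly (E i) N ℂ))
    {z z' : Fin ν × Fin ν → ℂ} (h : HomIndist ν k z z') (i : Fin M) :
    α i * (eval z (homPoly (E i) ν ℂ) - eval z' (homPoly (E i) ν ℂ)) = 0 := by
  have key := kroneckerSubst_eq_of_determined (m := m) e hdet h
  rw [kroneckerSubst_sum_homPoly, kroneckerSubst_sum_homPoly] at key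
  have hsum : ∑ j, C (α j * (eval z (homPoly (E j) ν ℂ) - eval z' (homPoly (E j) ν ℂ))) * homPoly (E j) m ℂ = 0 := by
    have : ∑ j, C (α j * (eval z (homPoly (E j) ν ℂ) - eval z' (homPoly (E j) ν ℂ))) * homPoly (E j) m ℂ =
        ∑ j, C (α j * eval z (homPoly (E j) ν ℂ)) * homPoly (E j) m ℂ -
          ∑ j, C (α j * eval z' (homPoly (E j) ν ℂ)) * homPoly (E j) m ℂ := by
      rw [← Finset.sum_sub_distrib]
      refine Finset.sum_congr rfl fun j _ => ?_
      rw [mul_sub, map_sub, sub_mul]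
    rw [this, key, sub_self]
  have hβ := HomExpansionUnique.homPoly_linearIndependent (K := ℂ) m M a b E
    (fun j => α j * (eval z (homPoly (E j) ν ℂ) - eval z' (homPoly (E j) ν ℂ))) hle hrow hcol hiso hsum
  exact congr_fun hβ i

/-- **Every pattern with a nonzero coefficient in a determined expansion is itself determined at the smaller level** —
it lies in the weighted non-uniform homomorphism-distinguishing closure `cl_ν(tw < k)`.
[cite: DawarPagoSeppelt2025, §7.1.1 and Thm 7.11 (Claim 3)] -/
theorem eval_homPoly_eq_of_determined_of_coeff_ne_zero {N m ν k M : ℕ} (e : Fin N ≃ Fin m × Fin ν)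
    (a b : Fin M → ℕ) (E : (i : Fin M) → Multiset (Fin (a i) × Fin (b i))) (α : Fin M → ℂ)
    (hle : ∀ i, a i ≤ m ∧ b i ≤ m)
    (hrow : ∀ i (u : Fin (a i)), ∃ x ∈ E i, x.1 = u)
    (hcol : ∀ i (v : Fin (b i)), ∃ x ∈ E i, x.2 = v)
    (hiso : ∀ i j, i ≠ j → ∀ (ea : Fin (a i) ≃ Fin (a j)) (eb : Fin (b i) ≃ Fin (b j)),
      ((E i).map fun x => (ea x.1, eb x.2)) ≠ E j)
    (hdet : ∀ A B : Fin N × Fin N → ℂ, HomIndist N k A B →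
      eval A (∑ i, C (α i) * homPoly (E i) N ℂ) = eval B (∑ i, C (α i) * homPoly (E i) N ℂ))
    {i : Fin M} (hi : α i ≠ 0) {z z' : Fin ν × Fin ν → ℂ} (h : HomIndist ν k z z') :
    eval z (homPoly (E i) ν ℂ) = eval z' (homPoly (E i) ν ℂ) := by
  have h0 := coeff_mul_sub_eval_eq_zero_of_determined e a b E α hle hrow hcol hiso hdet h i
  rcases mul_eq_zero.1 h0 with h1 | h1
  · exact absurd h1 hi
  · exact sub_eq_zero.1 h1

/-- **The family form, on the line's node `PolylogHomDetermined` (unfolded verbatim).**  If the values of every `f n` on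
`ℂ^{n×n}` are determined by `HomIndist n ((log₂ n + c)^c)`, then at every product level `N = m·ν` every bipartite multigraph
pattern without isolated vertices and with at most `m` vertices a side that occurs with a nonzero coefficient in an
expansion of `f N` over pairwise non-isomorphic such patterns takes equal values at any two points of `ℂ^{ν×ν}` that are
hom-indistinguishable below treewidth `(log₂ N + c)^c`.  (With `ν` fixed and `N → ∞` these are the patterns of volume
`≤ N/ν`: the sublinear regime of Dawar–Pago–Seppelt 2025 Thm 7.9, in weighted currency and without padding.)
[cite: DawarPagoSeppelt2025, Thm 7.9, Thm 7.11; DwivediPagoSeppelt2026, Lemma 8.18] -/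
theorem eval_homPoly_eq_of_polylogHomDetermined (f : (n : ℕ) → MvPolynomial (Fin n × Fin n) ℂ) (c : ℕ)
    (hf : ∀ (n : ℕ) (A B : Fin n × Fin n → ℂ), HomIndist n ((Nat.log 2 n + c) ^ c) A B →
      eval A (f n) = eval B (f n))
    (m ν : ℕ) {M : ℕ} (a b : Fin M → ℕ) (E : (i : Fin M) → Multiset (Fin (a i) × Fin (b i))) (α : Fin M → ℂ)
    (hle : ∀ i, a i ≤ m ∧ b i ≤ m)
    (hrow : ∀ i (u : Fin (a i)), ∃ x ∈ E i, x.1 = u)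
    (hcol : ∀ i (v : Fin (b i)), ∃ x ∈ E i, x.2 = v)
    (hiso : ∀ i j, i ≠ j → ∀ (ea : Fin (a i) ≃ Fin (a j)) (eb : Fin (b i) ≃ Fin (b j)),
      ((E i).map fun x => (ea x.1, eb x.2)) ≠ E j)
    (hexp : f (m * ν) = ∑ i, C (α i) * homPoly (E i) (m * ν) ℂ)
    {i : Fin M} (hi : α i ≠ 0) {z z' : Fin ν × Fin ν → ℂ}
    (h : HomIndist ν ((Nat.log 2 (m * ν) + c) ^ c) z z') :
    eval z (homPoly (E i) ν ℂ) = eval z' (homPoly (E i) ν ℂ) := by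
  refine eval_homPoly_eq_of_determined_of_coeff_ne_zero finProdFinEquiv.symm a b E α hle hrow hcol hiso ?_ hi h
  intro A B hAB
  rw [← hexp]
  exact hf _ A B hAB

end Summit.ValiantsHypothesis.ValiantsHypothesis.Theorems.KroneckerMonotonicity

end
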